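import Literature.Analysis.Fourier.ChirpCutoffs
import Literature.Analysis.Fourier.ChirpPhase
import HarnessLib

/-!
# Non-stationary phase for chirped oscillatory integrals: the integration-by-parts step

The setting of a *super-Nyquist chirp* (`ChirpPhase φ H L Cφ`, file `ChirpPhase.lean`): a smooth real phase `φ` with
`φ' ≥ L > 0` on `[H, ∞)` (`H ≥ 1`) and symbol bounds `|φ^{(j)}(t)| ≤ C_j t^{1-j} log(t+2)`
(`j ≥ 1`). For an integer `k ≠ 0` and a real frequency `u` with `|u/(2πk)| < L` the phase
`θ(τ) = uτ + 2πkφ(τ)` of `e(τ) = e^{iθ(τ)}` (`chirpE`) has NO stationary point on `(H, ∞)`: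
`θ' = 2πk (u/(2πk) + φ')` with `u/(2πk) + φ' ≥ L - |u/(2πk)| > 0`. One integration by parts
(`integral_amp_chirpE_eq`): for a real amplitude `a`, smooth on `(H, ∞)`, vanishing below
`H + 1/4` and far out,
`∫_{τ>H} a e = (i/2πk) ∫_{τ>H} (a v)' e`, `v = 1/(u/(2πk) + φ')` (`vInv`, `Dop1`);
iterated `m` times (`integral_amp_chirpE_eq_iterate`). The symbol calculus of
`ChirpSymbolCalculus.lean` controls the iterated amplitudes uniformly (`symBnd_iterate_Dfam`:
order drops by one per step). Source: Stein, *Harmonic Analysis* (1993), Ch. VIII §1.2,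
Prop. 1–2; Hörmander, *ALPDO I*, Thm 7.7.1. Everything here is proved; no named facts.
-/

noncomputable section

open Set Filter MeasureTheory
open scoped Topology ContDiff Real

namespace Literature.Analysis.Fourier

open _root_.Complex (I exp)

variable {ι : Type*}

/-! ## The phase factor and one integration by parts -/

/-- The phase factor `e(τ) = exp(i(uτ + 2πkφ(τ)))`. [folklore] -/
def chirpE (φ : ℝ → ℝ) (k : ℤ) (u τ : ℝ) : ℂ :=
  exp (((u * τ + 2 * π * k * φ τ : ℝ) : ℂ) * I)

/-- The reciprocal slope `v(τ) = 1/(u/(2πk) + φ'(τ))`. [folklore] -/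
def vInv (φ : ℝ → ℝ) (k : ℤ) (u τ : ℝ) : ℝ := (u / (2 * π * k) + deriv φ τ)⁻¹

/-- The integration-by-parts operator `D a = (a v)'` on single amplitudes. [folklore] -/
def Dop1 (v a : ℝ → ℝ) : ℝ → ℝ := deriv (fun s => a s * v s)

/-- The same operator acting on families of amplitudes. [folklore] -/
def Dfam (v a : ι → ℝ → ℝ) : ι → ℝ → ℝ := fun i => Dop1 (v i) (a i)

/-- Iterates of the family operator act member-wise. [folklore] -/
theorem iterate_Dfam_apply (v a : ι → ℝ → ℝ) (m : ℕ) (i : ι) :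
    ((Dfam v)^[m] a) i = (Dop1 (v i))^[m] (a i) := by
  induction m generalizing a with
  | zero => rfl
  | succ m ih => rw [Function.iterate_succ_apply, Function.iterate_succ_apply, ih]; rfl

/-- `‖e(τ)‖ = 1`. [folklore] -/
theorem norm_chirpE (φ : ℝ → ℝ) (k : ℤ) (u τ : ℝ) : ‖chirpE φ k u τ‖ = 1 :=
  Complex.norm_exp_ofReal_mul_I _

/-- `e` is continuous when `φ` is. [folklore] -/
theorem continuous_chirpE {φ : ℝ → ℝ} (hφ : Continuous φ) (k : ℤ) (u : ℝ) :
    Continuous (chirpE φ k u) := by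
  unfold chirpE; fun_prop

/-- `e' = e · i(u + 2πkφ')`. [folklore] -/
theorem hasDerivAt_chirpE {φ : ℝ → ℝ} {H L : ℝ} {Cφ : ℕ → ℝ} (hφ : ChirpPhase φ H L Cφ) (k : ℤ)
    (u τ : ℝ) : HasDerivAt (chirpE φ k u)
      (chirpE φ k u τ * (((u + 2 * π * k * deriv φ τ : ℝ) : ℂ) * I)) τ := by
  have h0 : HasDerivAt (fun τ => u * τ + 2 * π * k * φ τ) (u * 1 + 2 * π * k * deriv φ τ) τ :=
    ((hasDerivAt_id τ).const_mul u).add ((hφ.hasDerivAt τ).const_mul (2 * π * k))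
  have h1 : HasDerivAt (fun τ => u * τ + 2 * π * k * φ τ) (u + 2 * π * k * deriv φ τ) τ :=
    h0.congr_deriv (by ring)
  exact (h1.ofReal_comp.mul_const I).cexp

/-- A *good amplitude*: smooth on `(H, ∞)`, vanishing below `H + 1/4` and beyond some `R`.
[folklore] -/
def GoodAmp (H : ℝ) (a : ℝ → ℝ) : Prop :=
  ContDiffOn ℝ ∞ a (Ioi H) ∧ (∀ τ, τ < H + 1 / 4 → a τ = 0) ∧ ∃ R, ∀ τ, R < τ → a τ = 0

/-- `D` preserves good amplitudes (for `v` smooth on `(H, ∞)`). [folklore] -/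
theorem GoodAmp.dop1 {H : ℝ} {a v : ℝ → ℝ} (ha : GoodAmp H a) (hv : ContDiffOn ℝ ∞ v (Ioi H)) :
    GoodAmp H (Dop1 v a) := by
  obtain ⟨hs, hz, R, hR⟩ := ha
  refine ⟨((contDiffOn_infty_iff_deriv_of_isOpen isOpen_Ioi).1 (hs.mul hv)).2, ?_, R, ?_⟩
  · intro τ hτ
    have : (fun s => a s * v s) =ᶠ[𝓝 τ] fun _ => 0 := by
      filter_upwards [Iio_mem_nhds hτ] with s hs
      rw [hz s hs, zero_mul]
    rw [Dop1, this.deriv_eq, deriv_const]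
  · intro τ hτ
    have : (fun s => a s * v s) =ᶠ[𝓝 τ] fun _ => 0 := by
      filter_upwards [Ioi_mem_nhds hτ] with s hs
      rw [hR s hs, zero_mul]
    rw [Dop1, this.deriv_eq, deriv_const]

/-- Iterates of `D` preserve good amplitudes. [folklore] -/
theorem GoodAmp.iterate {H : ℝ} {a v : ℝ → ℝ} (ha : GoodAmp H a) (hv : ContDiffOn ℝ ∞ v (Ioi H))
    (m : ℕ) : GoodAmp H ((Dop1 v)^[m] a) := by
  induction m with
  | zero => exact ha
  | succ m ih => rw [Function.iterate_succ_apply']; exact ih.dop1 hv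

/-- If `a` vanishes on an open set, so does `D a`. [folklore] -/
theorem Dop1_eq_zero_of_eqOn {U : Set ℝ} (hU : IsOpen U) {a v : ℝ → ℝ} (ha : ∀ τ ∈ U, a τ = 0) :
    ∀ τ ∈ U, Dop1 v a τ = 0 := by
  intro τ hτ
  have : (fun s => a s * v s) =ᶠ[𝓝 τ] fun _ => 0 := by
    filter_upwards [hU.mem_nhds hτ] with s hs
    rw [ha s hs, zero_mul]
  rw [Dop1, this.deriv_eq, deriv_const]

/-- If `a` vanishes on an open set, so do all `D^m a`. [folklore] -/
theorem iterate_Dop1_eq_zero_of_eqOn {U : Set ℝ} (hU : IsOpen U) {a : ℝ → ℝ} (v : ℝ → ℝ)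
    (ha : ∀ τ ∈ U, a τ = 0) (m : ℕ) : ∀ τ ∈ U, (Dop1 v)^[m] a τ = 0 := by
  induction m with
  | zero => exact ha
  | succ m ih => rw [Function.iterate_succ_apply']; exact Dop1_eq_zero_of_eqOn hU ih

/-- A function continuous on `(H, ∞)` and vanishing below `H + 1/4` is continuous on `ℝ`.
[folklore] -/
theorem continuous_of_zero_below {H : ℝ} {E : Type*} [TopologicalSpace E] [Zero E] {f : ℝ → E}
    (hf : ContinuousOn f (Ioi H)) (hz : ∀ τ, τ < H + 1 / 4 → f τ = 0) : Continuous f := by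
  rw [continuous_iff_continuousAt]
  intro τ
  by_cases hτ : τ < H + 1 / 4
  · have : f =ᶠ[𝓝 τ] fun _ => 0 := by
      filter_upwards [Iio_mem_nhds hτ] with s hs using hz s hs
    exact (continuousAt_congr this).2 continuousAt_const
  · exact hf.continuousAt (Ioi_mem_nhds (by linarith))

/-- A good complex integrand is integrable on `(H, ∞)`. [folklore] -/
theorem integrableOn_Ioi_of_zero {E : Type*} [NormedAddCommGroup E] {H R : ℝ} {f : ℝ → E}
    (hf : ContinuousOn f (Ioi H))
    (hz : ∀ τ, τ < H + 1 / 4 → f τ = 0) (hR : ∀ τ, R < τ → f τ = 0) :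
    IntegrableOn f (Ioi H) := by
  have h1 : IntegrableOn f (Icc (H + 1 / 4) R) :=
    (hf.mono fun τ hτ => lt_of_lt_of_le (by linarith) hτ.1).integrableOn_compact isCompact_Icc
  refine h1.of_forall_sdiff_eq_zero measurableSet_Ioi fun x hx => ?_
  have hx2 : ¬ (H + 1 / 4 ≤ x ∧ x ≤ R) := hx.2
  rcases not_and_or.mp hx2 with h | h
  · exact hz x (not_le.mp h)
  · exact hR x (not_le.mp h)

/-- **One integration by parts against a non-stationary chirped phase.** For a good real
amplitude `a` on `(H, ∞)`, an integer `k ≠ 0` and `u` with `u/(2πk) + φ' > 0` on `(H, ∞)`: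
`∫_{τ>H} a e = (i/(2πk)) ∫_{τ>H} (a v)' e` where `v = 1/(u/(2πk) + φ')`, `e = e^{i(uτ+2πkφ)}`
(no boundary terms: `a` vanishes near `H` and far out). [folklore] -/
theorem integral_amp_chirpE_eq {φ : ℝ → ℝ} {H L : ℝ} {Cφ : ℕ → ℝ} (hφ : ChirpPhase φ H L Cφ)
    {k : ℤ} (hk : k ≠ 0) {u : ℝ} (hden : ∀ τ, H < τ → 0 < u / (2 * π * k) + deriv φ τ)
    {a : ℝ → ℝ} (ha : GoodAmp H a) :
    ∫ τ in Ioi H, (a τ : ℂ) * chirpE φ k u τ =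
      (I / (2 * π * k)) * ∫ τ in Ioi H, ((Dop1 (vInv φ k u) a τ : ℝ) : ℂ) * chirpE φ k u τ := by
  obtain ⟨hs, hz, R, hR⟩ := ha
  set v := vInv φ k u with hv_def
  have hvs : ContDiffOn ℝ ∞ v (Ioi H) :=
    (contDiff_const.add hφ.contDiff_deriv).contDiffOn.inv fun τ hτ => (hden τ hτ).ne'
  have hDa : GoodAmp H (Dop1 v a) := GoodAmp.dop1 ⟨hs, hz, R, hR⟩ hvs
  set e := chirpE φ k u with he_def
  have hec : Continuous e := continuous_chirpE hφ.smooth.continuous k u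
  set c : ℂ := 2 * π * k * I with hc_def
  have hc0 : c ≠ 0 := by
    rw [hc_def]
    have : (k : ℂ) ≠ 0 := Int.cast_ne_zero.mpr hk
    have : (π : ℂ) ≠ 0 := Complex.ofReal_ne_zero.mpr Real.pi_ne_zero
    exact mul_ne_zero (mul_ne_zero (mul_ne_zero two_ne_zero this) ‹(k:ℂ) ≠ 0›) Complex.I_ne_zero
  -- the primitive `B = (a v) e` and its derivative on `(H, ∞)`
  set B : ℝ → ℂ := fun τ => ((a τ * v τ : ℝ) : ℂ) * e τ with hB_def
  set B' : ℝ → ℂ := fun τ => ((Dop1 v a τ : ℝ) : ℂ) * e τ + c * ((a τ : ℂ) * e τ) with hB'_def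
  have hderiv : ∀ τ ∈ Ioi H, HasDerivAt B (B' τ) τ := by
    intro τ hτ
    have hτ' : Ioi H ∈ 𝓝 τ := Ioi_mem_nhds hτ
    have hav : HasDerivAt (fun s => a s * v s) (Dop1 v a τ) τ :=
      (((hs.mul hvs).differentiableOn (by simp)).differentiableAt hτ').hasDerivAt
    have h1 := (hav.ofReal_comp).fun_mul (hasDerivAt_chirpE hφ k u τ)
    refine h1.congr_deriv ?_
    have hvd : v τ * (u / (2 * π * k) + deriv φ τ) = 1 := by
      rw [hv_def, vInv, inv_mul_cancel₀ (hden τ hτ).ne']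
    have hk' : (k : ℂ) ≠ 0 := Int.cast_ne_zero.mpr hk
    have hπ : (π : ℂ) ≠ 0 := Complex.ofReal_ne_zero.mpr Real.pi_ne_zero
    have key : ((a τ * v τ : ℝ) : ℂ) * (((u + 2 * π * k * deriv φ τ : ℝ) : ℂ) * I) =
        c * (a τ : ℂ) := by
      have h2 : ((u + 2 * π * k * deriv φ τ : ℝ) : ℂ) =
          2 * π * k * ((u / (2 * π * k) + deriv φ τ : ℝ) : ℂ) := by
        push_cast
        field_simp
      have h3 : ((a τ * v τ : ℝ) : ℂ) * ((u / (2 * π * k) + deriv φ τ : ℝ) : ℂ) = a τ := by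
        rw [← Complex.ofReal_mul, mul_assoc, hvd, mul_one]
      rw [h2, hc_def]
      linear_combination (2 * π * k * I) * h3
    simp only [hB'_def, he_def]
    linear_combination (chirpE φ k u τ) * key
  -- integrability of the two pieces
  have hz' : ∀ τ, τ < H + 1 / 4 → (fun τ => (a τ : ℂ) * e τ) τ = 0 := fun τ hτ => by
    simp [hz τ hτ]
  have hR' : ∀ τ, R < τ → (fun τ => (a τ : ℂ) * e τ) τ = 0 := fun τ hτ => by simp [hR τ hτ]
  have hI1 : IntegrableOn (fun τ => (a τ : ℂ) * e τ) (Ioi H) :=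
    integrableOn_Ioi_of_zero (R := R)
      ((Complex.continuous_ofReal.comp_continuousOn hs.continuousOn).mul hec.continuousOn) hz' hR'
  obtain ⟨hDs, hDz, R₂, hDR⟩ := hDa
  have hI2 : IntegrableOn (fun τ => ((Dop1 v a τ : ℝ) : ℂ) * e τ) (Ioi H) :=
    integrableOn_Ioi_of_zero (R := R₂)
      ((Complex.continuous_ofReal.comp_continuousOn hDs.continuousOn).mul hec.continuousOn)
      (fun τ hτ => by simp [hDz τ hτ]) (fun τ hτ => by simp [hDR τ hτ])
  have hI' : IntegrableOn B' (Ioi H) := hI2.add (hI1.const_mul c)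
  -- `∫ B' = 0`
  have hBz : ∀ τ, τ < H + 1 / 4 → B τ = 0 := fun τ hτ => by simp [hB_def, hz τ hτ]
  have hcont : ContinuousWithinAt B (Ici H) H := by
    have : B =ᶠ[𝓝 H] fun _ => 0 := by
      filter_upwards [Iio_mem_nhds (show H < H + 1 / 4 by linarith)] with s hs using hBz s hs
    exact ((continuousAt_congr this).2 continuousAt_const).continuousWithinAt
  have hlim : Tendsto B atTop (𝓝 0) := by
    apply tendsto_const_nhds.congr'
    filter_upwards [Ioi_mem_atTop R] with τ hτ
    simp [hB_def, hR τ hτ]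
  have hint := integral_Ioi_of_hasDerivAt_of_tendsto hcont hderiv hI' hlim
  rw [hBz H (by linarith), sub_zero] at hint
  -- conclude
  have hsplit : ∫ τ in Ioi H, B' τ = (∫ τ in Ioi H, ((Dop1 v a τ : ℝ) : ℂ) * e τ) +
      c * ∫ τ in Ioi H, (a τ : ℂ) * e τ := by
    rw [hB'_def, integral_add hI2 (hI1.const_mul c), integral_const_mul]
  rw [hsplit] at hint
  have h2 : ∫ τ in Ioi H, ((Dop1 v a τ : ℝ) : ℂ) * e τ = -c * ∫ τ in Ioi H, (a τ : ℂ) * e τ := by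
    linear_combination hint
  have hk' : (k : ℂ) ≠ 0 := Int.cast_ne_zero.mpr hk
  have hπ : (π : ℂ) ≠ 0 := Complex.ofReal_ne_zero.mpr Real.pi_ne_zero
  have h3 : I / (2 * π * k) * (-c) = 1 := by
    rw [hc_def]
    field_simp
    rw [Complex.I_sq]
    ring
  rw [h2, ← mul_assoc, h3, one_mul]

/-- **Iterated integration by parts**: `∫_{τ>H} a e = (i/(2πk))^m ∫_{τ>H} (D^m a) e`.
[folklore] -/
theorem integral_amp_chirpE_eq_iterate {φ : ℝ → ℝ} {H L : ℝ} {Cφ : ℕ → ℝ}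
    (hφ : ChirpPhase φ H L Cφ) {k : ℤ} (hk : k ≠ 0) {u : ℝ}
    (hden : ∀ τ, H < τ → 0 < u / (2 * π * k) + deriv φ τ) {a : ℝ → ℝ} (ha : GoodAmp H a)
    (m : ℕ) :
    ∫ τ in Ioi H, (a τ : ℂ) * chirpE φ k u τ =
      (I / (2 * π * k)) ^ m *
        ∫ τ in Ioi H, (((Dop1 (vInv φ k u))^[m] a τ : ℝ) : ℂ) * chirpE φ k u τ := by
  have hvs : ContDiffOn ℝ ∞ (vInv φ k u) (Ioi H) :=
    (contDiff_const.add hφ.contDiff_deriv).contDiffOn.inv fun τ hτ => (hden τ hτ).ne'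
  induction m with
  | zero => simp
  | succ m ih =>
    rw [ih, integral_amp_chirpE_eq hφ hk hden (ha.iterate hvs m), ← mul_assoc, pow_succ,
      Function.iterate_succ_apply']

/-! ## Uniform control of the iterated amplitudes -/

/-- Re-targeting the order of a symbol family along an equality of exponents. [folklore] -/
theorem SymBnd.of_eq {S : Set ι} {H n n' : ℝ} {R : ℕ} {a : ι → ℝ → ℝ} (h : SymBnd S H n R a)
    (hn : n = n') : SymBnd S H n' R a := hn ▸ h

/-- **The iterated amplitudes `D^m a` form a uniform symbol family of order `n - m`** when `a`
has order `n` and `v` has order `0` (each step: Leibniz, then one derivative). [folklore] -/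
theorem symBnd_iterate_Dfam {S : Set ι} {H : ℝ} (hH : 1 ≤ H) {v : ι → ℝ → ℝ}
    (hv : SmoothFam S H v) (hvs : ∀ R, SymBnd S H 0 R v) :
    ∀ (m : ℕ) (n : ℝ) (R : ℕ) (a : ι → ℝ → ℝ), SmoothFam S H a → SymBnd S H n (R + m) a →
      SmoothFam S H ((Dfam v)^[m] a) ∧ SymBnd S H (n - m) R ((Dfam v)^[m] a) := by
  intro m
  induction m with
  | zero =>
    intro n R a ha has
    exact ⟨ha, by simpa using has⟩
  | succ m ih =>
    intro n R a ha has
    have hDa_s : SmoothFam S H (Dfam v a) := (ha.mul hv).deriv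
    have hDa : SymBnd S H (n - 1) (R + m) (Dfam v a) := by
      have h1 : SymBnd S H (n + 0) (R + m + 1) (fun i τ => a i τ * v i τ) :=
        SymBnd.mul hH ha hv (by simpa [add_assoc] using has) (hvs _)
      exact (h1.deriv).of_eq (by ring)
    obtain ⟨h1, h2⟩ := ih (n - 1) R (Dfam v a) hDa_s hDa
    rw [Function.iterate_succ_apply]
    exact ⟨h1, h2.of_eq (by push_cast; ring)⟩

/-! ## Size of the remainder integrals -/

/-- `(log(τ+2))^p ≤ C_p τ^{1/2}` for `τ ≥ 1`. [folklore] -/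
theorem exists_log_pow_le_sqrt (p : ℕ) :
    ∃ C : ℝ, 0 ≤ C ∧ ∀ τ : ℝ, 1 ≤ τ → Real.log (τ + 2) ^ p ≤ C * τ ^ (1 / 2 : ℝ) := by
  rcases Nat.eq_zero_or_pos p with rfl | hp
  · refine ⟨1, zero_le_one, fun τ hτ => ?_⟩
    rw [pow_zero, one_mul]
    exact Real.one_le_rpow hτ (by norm_num)
  · set ε : ℝ := 1 / (2 * p) with hε
    have hεpos : 0 < ε := by rw [hε]; positivity
    refine ⟨ε⁻¹ ^ p * (3 : ℝ) ^ (1 / 2 : ℝ), by positivity, fun τ hτ => ?_⟩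
    have hτ0 : 0 < τ := by linarith
    have h1 : Real.log (τ + 2) ≤ (τ + 2) ^ ε / ε := Real.log_le_rpow_div (by linarith) hεpos
    have h2 : 0 ≤ Real.log (τ + 2) := Real.log_nonneg (by linarith)
    have h3 : Real.log (τ + 2) ^ p ≤ ((τ + 2) ^ ε / ε) ^ p := pow_le_pow_left₀ h2 h1 p
    have h4 : ((τ + 2) ^ ε) ^ p = (τ + 2) ^ (1 / 2 : ℝ) := by
      rw [← Real.rpow_natCast, ← Real.rpow_mul (by linarith)]
      congr 1
      rw [hε]
      field_simp
    have h5 : (τ + 2) ^ (1 / 2 : ℝ) ≤ (3 * τ) ^ (1 / 2 : ℝ) :=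
      Real.rpow_le_rpow (by linarith) (by linarith) (by norm_num)
    calc Real.log (τ + 2) ^ p ≤ ((τ + 2) ^ ε / ε) ^ p := h3
      _ = ε⁻¹ ^ p * (τ + 2) ^ (1 / 2 : ℝ) := by rw [div_eq_mul_inv, mul_pow, h4]; ring
      _ ≤ ε⁻¹ ^ p * (3 * τ) ^ (1 / 2 : ℝ) := by gcongr
      _ = ε⁻¹ ^ p * (3 : ℝ) ^ (1 / 2 : ℝ) * τ ^ (1 / 2 : ℝ) := by
          rw [Real.mul_rpow (by norm_num) hτ0.le]; ring

/-- From an order `≤ -2` symbol bound at level `0` to the clean majorant `C τ^{-3/2}`. [folklore] -/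
theorem SymBnd.exists_le_rpow {S : Set ι} {H n : ℝ} {R : ℕ} {b : ι → ℝ → ℝ} (hH : 1 ≤ H)
    (hb : SymBnd S H n R b) (hn : n ≤ -2) :
    ∃ C : ℝ, 0 ≤ C ∧ ∀ i ∈ S, ∀ τ, H < τ → |b i τ| ≤ C * τ ^ (-(3 / 2) : ℝ) := by
  obtain ⟨C, hC, p, h⟩ := hb 0 (Nat.zero_le _)
  obtain ⟨C', hC', h'⟩ := exists_log_pow_le_sqrt p
  refine ⟨C * C', mul_nonneg hC hC', fun i hi τ hτ => ?_⟩
  have hτ1 : 1 ≤ τ := hH.trans hτ.le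
  have hτ0 : 0 < τ := by linarith
  have e1 := h i hi τ hτ
  rw [iteratedDeriv_zero, Nat.cast_zero, sub_zero] at e1
  have e2 := h' τ hτ1
  have e3 : τ ^ n ≤ τ ^ (-2 : ℝ) := Real.rpow_le_rpow_of_exponent_le hτ1 hn
  calc |b i τ| ≤ C * τ ^ n * Real.log (τ + 2) ^ p := e1
    _ ≤ C * τ ^ (-2 : ℝ) * (C' * τ ^ (1 / 2 : ℝ)) := by
        apply mul_le_mul (mul_le_mul_of_nonneg_left e3 hC) e2
          (pow_nonneg (Real.log_nonneg (by linarith)) _)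
        exact mul_nonneg hC (Real.rpow_nonneg hτ0.le _)
    _ = C * C' * (τ ^ (-2 : ℝ) * τ ^ (1 / 2 : ℝ)) := by ring
    _ = C * C' * τ ^ (-(3 / 2) : ℝ) := by rw [← Real.rpow_add hτ0]; norm_num

/-- **Tail bound.** If `|b| ≤ C τ^{-3/2}` on `(H, ∞)` and `b` vanishes on `(H, T₀)` (`T₀ ≥ H ≥ 1`),
then `∫_{τ>H} ‖b e‖ ≤ 2 C T₀^{-1/2}`. [folklore] -/
theorem norm_integral_amp_chirpE_le {φ : ℝ → ℝ} (k : ℤ) (u : ℝ) {H T₀ C : ℝ} (hH : 1 ≤ H)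
    (hT₀ : H ≤ T₀) {b : ℝ → ℝ} (hbi : IntegrableOn (fun τ => (b τ : ℂ) * chirpE φ k u τ) (Ioi H))
    (hb : ∀ τ, H < τ → |b τ| ≤ C * τ ^ (-(3 / 2) : ℝ)) (hz : ∀ τ, H < τ → τ < T₀ → b τ = 0) :
    ‖∫ τ in Ioi H, (b τ : ℂ) * chirpE φ k u τ‖ ≤ 2 * C * T₀ ^ (-(1 / 2) : ℝ) := by
  have hT₀pos : 0 < T₀ := by linarith
  have hnorm : ∀ τ, ‖(b τ : ℂ) * chirpE φ k u τ‖ = |b τ| := fun τ => by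
    rw [norm_mul, norm_chirpE, mul_one, Complex.norm_real, Real.norm_eq_abs]
  have hbn : IntegrableOn (fun τ => |b τ|) (Ioi H) :=
    hbi.norm.congr (Eventually.of_forall fun τ => hnorm τ)
  have hCi : IntegrableOn (fun τ : ℝ => C * τ ^ (-(3 / 2) : ℝ)) (Ioi T₀) :=
    (integrableOn_Ioi_rpow_of_lt (by norm_num) hT₀pos).const_mul C
  calc ‖∫ τ in Ioi H, (b τ : ℂ) * chirpE φ k u τ‖
      ≤ ∫ τ in Ioi H, ‖(b τ : ℂ) * chirpE φ k u τ‖ := norm_integral_le_integral_norm _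
    _ = ∫ τ in Ioi H, |b τ| := integral_congr_ae (Eventually.of_forall fun τ => hnorm τ)
    _ = (∫ τ in Ioc H T₀, |b τ|) + ∫ τ in Ioi T₀, |b τ| := by
        rw [← setIntegral_union (Ioc_disjoint_Ioi le_rfl) measurableSet_Ioi
          (hbn.mono_set Ioc_subset_Ioi_self) (hbn.mono_set (Ioi_subset_Ioi hT₀)),
          Ioc_union_Ioi_eq_Ioi hT₀]
    _ = ∫ τ in Ioi T₀, |b τ| := by
        rw [integral_Ioc_eq_integral_Ioo, setIntegral_eq_zero_of_forall_eq_zero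
          (fun τ hτ => by rw [hz τ hτ.1 hτ.2, abs_zero]), zero_add]
    _ ≤ ∫ τ in Ioi T₀, C * τ ^ (-(3 / 2) : ℝ) :=
        setIntegral_mono_on (hbn.mono_set (Ioi_subset_Ioi hT₀)) hCi measurableSet_Ioi
          fun τ hτ => hb τ (lt_of_le_of_lt hT₀ hτ)
    _ = 2 * C * T₀ ^ (-(1 / 2) : ℝ) := by
        rw [integral_const_mul, integral_Ioi_rpow_of_lt (by norm_num) hT₀pos]
        have : (-(3 / 2) + 1 : ℝ) = -(1 / 2) := by norm_num
        rw [this]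
        ring

end Literature.Analysis.Fourier
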